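import Literature.AlgebraicGeometry.Frobenioids.QuasiTemperoid
import Mathlib.GroupTheory.GroupAction.SubMulAction
import Mathlib.Algebra.Group.Action.Sum
import Mathlib.CategoryTheory.Limits.Shapes.BinaryProducts
import HarnessLib

/-!
# Frobenioids II, Example 1.3 (i): the connected objects of `B^temp(Π, Π°)` (proofs, part 1)

Mochizuki, *The geometry of Frobenioids II*, Kyushu J. Math. **62** (2008) 401–460, §1 Example 1.3
(i), author's text p. 11 [cite: MochizukiFrdII2008, Ex 1.3 (i) p.11].  The claims about
`E⁰ = B^temp(Π, Π°)⁰` recorded as named facts in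
`Literature.AlgebraicGeometry.Frobenioids.QuasiTemperoid` ("`E⁰` is connected, totally epimorphic,
of strongly indissectible type and of FSM-type") all rest on the description of the connected
objects
of `B^temp(Π, Π°)` (`BTempRel Π Π°`): an object is connected in the sense of [FrdI] §0 (non-initial
and not a coproduct of two non-initial objects) iff its underlying `Π`-set is a single orbit.  This
proof-only file (no definitions) establishes that description and the elementary consequences used
by the companion `QuasiTemperoidProofs.lean`: `Π`-maps out of a single orbit are determined by one
value, are surjective onto single orbits, and descend along stabiliser inclusions.  Auxiliary
`Π`-sets (orbits and their complements, the empty `Π`-set, disjoint unions) are built inside the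
proofs, exactly as in L3's `TemperedGroupsProofs.lean` for `B^temp(Π)`.
-/

open CategoryTheory CategoryTheory.Limits Topology
open Literature.AnabelianGeometry.SemiGraphs

namespace Literature.AlgebraicGeometry.Frobenioids

namespace QuasiTemperoid

namespace BTempRel

universe u

variable {G : Type u} [Group G] [TopologicalSpace G] {H : Subgroup G}

/-! ### Toolkit: equivariance, extensionality, empty and full objects of `B^temp(Π, Π°)` -/

/-- Equivariance of a morphism of `B^temp(Π, Π°)`, pointwise.
(Step of the verification of FrdII Ex. 1.3 (i).)
[cite: MochizukiFrdII2008, Ex 1.3 (i) p.11] -/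
theorem hom_ρ {T₁ T₂ : BTempRel G H} (f : T₁ ⟶ T₂) (g : G) (x : T₁.obj.obj.V) :
    (f.hom.hom.hom (T₁.obj.obj.ρ g x) : T₂.obj.obj.V) = T₂.obj.obj.ρ g (f.hom.hom.hom x) :=
  ConcreteCategory.congr_hom (f.hom.hom.comm g) x

/-- Morphisms of `B^temp(Π, Π°)` are determined by their underlying functions.
(Step of the verification of FrdII Ex. 1.3 (i).)
[cite: MochizukiFrdII2008, Ex 1.3 (i) p.11] -/
theorem hom_ext_apply {T₁ T₂ : BTempRel G H} {f f' : T₁ ⟶ T₂}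
    (h : ∀ x, (f.hom.hom.hom x : T₂.obj.obj.V) = f'.hom.hom.hom x) : f = f' :=
  ObjectProperty.hom_ext _ (ObjectProperty.hom_ext _ (Action.hom_ext _ _
    (ConcreteCategory.hom_ext _ _ h)))

/-- The action of `1` is trivial. (Step of the verification of FrdII Ex. 1.3 (i).)
[cite: MochizukiFrdII2008, Ex 1.3 (i) p.11] -/
theorem ρ_one_apply (T : BTempRel G H) (x : T.obj.obj.V) : T.obj.obj.ρ 1 x = x := by
  rw [Action.ρ_one]; rfl

/-- The action is multiplicative: `(g h) · x = g · (h · x)`.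
(Step of the verification of FrdII Ex. 1.3 (i).)
[cite: MochizukiFrdII2008, Ex 1.3 (i) p.11] -/
theorem ρ_mul_apply (T : BTempRel G H) (g h : G) (x : T.obj.obj.V) :
    T.obj.obj.ρ (g * h) x = T.obj.obj.ρ g (T.obj.obj.ρ h x) := by
  rw [map_mul]; rfl

/-- `g⁻¹` undoes `g`. (Step of the verification of FrdII Ex. 1.3 (i).)
[cite: MochizukiFrdII2008, Ex 1.3 (i) p.11] -/
theorem ρ_inv_apply (T : BTempRel G H) (g : G) (x : T.obj.obj.V) :
    T.obj.obj.ρ g⁻¹ (T.obj.obj.ρ g x) = x := by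
  rw [← ρ_mul_apply, inv_mul_cancel, ρ_one_apply]

/-- An object of `B^temp(Π, Π°)` with no points is initial.
(Step of the verification of FrdII Ex. 1.3 (i).)
[cite: MochizukiFrdII2008, Ex 1.3 (i) p.11] -/
theorem isInitial_of_isEmpty (T : BTempRel G H) (h : IsEmpty T.obj.obj.V) :
    Nonempty (IsInitial T) :=
  ⟨IsInitial.ofUniqueHom
    (fun _ => ObjectProperty.homMk (ObjectProperty.homMk
      { hom := TypeCat.ofHom (fun x => (h.false x).elim)
        comm := fun _ => ConcreteCategory.hom_ext _ _ fun x => (h.false x).elim }))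
    fun _ _ => hom_ext_apply fun x => (h.false x).elim⟩

/-- A non-initial object of `B^temp(Π, Π°)` has a point.
(Step of the verification of FrdII Ex. 1.3 (i).)
[cite: MochizukiFrdII2008, Ex 1.3 (i) p.11] -/
theorem nonempty_of_isNonemptyObj (T : BTempRel G H) (h : IsNonemptyObj T) :
    Nonempty T.obj.obj.V := by
  by_contra h'
  rw [not_nonempty_iff] at h'
  exact h.false (isInitial_of_isEmpty T h').some

/-- An object of `B^temp(Π, Π°)` with a point is not initial: map it to the empty `Π`-set.
(Step of the verification of FrdII Ex. 1.3 (i).)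
[cite: MochizukiFrdII2008, Ex 1.3 (i) p.11] -/
theorem isNonemptyObj_of_nonempty (T : BTempRel G H) (x : T.obj.obj.V) :
    IsNonemptyObj T := by
  constructor
  intro hI
  let EA : Action (Type u) G := { V := PEmpty.{u + 1}, ρ := 1 }
  let e : EA ⟶ cosetAction G H :=
    { hom := TypeCat.ofHom (fun z : PEmpty => z.elim)
      comm := fun _ => ConcreteCategory.hom_ext _ _ fun (z : PEmpty) => z.elim }
  let E : BTempRel G H := ⟨⟨EA, ⟨inferInstance, fun (z : PEmpty) => z.elim⟩⟩, ⟨e⟩⟩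
  exact ((hI.to E).hom.hom.hom x : PEmpty).elim

/-! ### Connected objects of `B^temp(Π, Π°)` are exactly the single orbits -/

/-- A connected object of `B^temp(Π, Π°)` is a single `Π`-orbit: otherwise it is the coproduct, in
`B^temp(Π, Π°)`, of an orbit and its (stable) complement, both non-initial (FrdII Ex. 1.3 (i),
the description of `E⁰` underlying p. 11). [cite: MochizukiFrdII2008, Ex 1.3 (i) p.11] -/
theorem exists_ρ_eq_of_isConnectedObj (T : BTempRel G H) (hT : IsConnectedObj T)
    (x₀ x : T.obj.obj.V) : ∃ g : G, T.obj.obj.ρ g x₀ = x := by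
  classical
  letI : MulAction G T.obj.obj.V := Action.instMulAction T.obj.obj
  by_contra hx
  obtain ⟨t⟩ := T.property
  -- sub-`Π`-sets as objects of `B^temp(Π, Π°)`, with their inclusions
  let BA : SubMulAction G T.obj.obj.V → Action (Type u) G := fun S =>
    { V := S, ρ := (Action.ofMulAction G S).ρ }
  let ιA : ∀ S : SubMulAction G T.obj.obj.V, BA S ⟶ T.obj.obj := fun S =>
    { hom := TypeCat.ofHom fun y : S => (y.1 : T.obj.obj.V)
      comm := fun _ => by
        apply ConcreteCategory.hom_ext
        intro y
        rfl }
  let B : SubMulAction G T.obj.obj.V → BTempRel G H := fun S =>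
    ⟨⟨BA S, by
      haveI : Countable T.obj.obj.V := T.obj.property.1
      refine ⟨inferInstanceAs (Countable S), fun (y : S) => ?_⟩
      change IsOpen {g : G | (Action.ofMulAction G S).ρ g y = y}
      have : {g : G | (Action.ofMulAction G S).ρ g y = y} =
          {g : G | T.obj.obj.ρ g y.1 = y.1} := by
        ext g
        simp only [Set.mem_setOf_eq]
        change g • y = y ↔ g • (y.1 : T.obj.obj.V) = y.1
        rw [Subtype.ext_iff, SubMulAction.val_smul]
      rw [this]
      exact T.obj.property.2 y.1⟩, ⟨ιA S ≫ t⟩⟩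
  let ι : ∀ S : SubMulAction G T.obj.obj.V, B S ⟶ T := fun S =>
    ObjectProperty.homMk (ObjectProperty.homMk (ιA S))
  -- a sub-`Π`-set with a point is not initial
  have hne : ∀ (S : SubMulAction G T.obj.obj.V) (_ : S), IsNonemptyObj (B S) := fun S y =>
    isNonemptyObj_of_nonempty (B S) y
  -- the orbit of `x₀` and its complement
  let S : SubMulAction G T.obj.obj.V :=
    { carrier := MulAction.orbit G x₀
      smul_mem' := fun g {_} hy => MulAction.mem_orbit_of_mem_orbit g hy }
  let Sc : SubMulAction G T.obj.obj.V :=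
    { carrier := (S : Set T.obj.obj.V)ᶜ
      smul_mem' := fun g {y} hy => by
        intro hgy
        apply hy
        have := S.smul_mem g⁻¹ hgy
        rwa [inv_smul_smul] at this }
  have hx' : x ∈ Sc := fun ⟨g, hg⟩ => hx ⟨g, hg⟩
  -- `T = S ⊔ Sc` in `B^temp(Π, Π°)`
  let d : ∀ s : BinaryCofan (B S) (B Sc), T.obj.obj.V → s.pt.obj.obj.V := fun s y =>
    if hy : y ∈ S then s.inl.hom.hom.hom (⟨y, hy⟩ : S) else s.inr.hom.hom.hom (⟨y, hy⟩ : Sc)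
  have hd₁ : ∀ s y (hy : y ∈ S), d s y = s.inl.hom.hom.hom (⟨y, hy⟩ : S) := fun s y hy => by
    simp only [d, dif_pos hy]
  have hd₂ : ∀ s y (hy : y ∉ S), d s y = s.inr.hom.hom.hom (⟨y, hy⟩ : Sc) := fun s y hy => by
    simp only [d, dif_neg hy]
  have hcol : Nonempty (IsColimit (BinaryCofan.mk (ι S) (ι Sc))) := by
    refine ⟨BinaryCofan.isColimitMk
      (fun s => ObjectProperty.homMk (ObjectProperty.homMk
        { hom := TypeCat.ofHom (d s)
          comm := fun g => ?_ })) ?_ ?_ ?_⟩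
    · apply ConcreteCategory.hom_ext
      intro y
      change d s (g • y) = s.pt.obj.obj.ρ g (d s y)
      by_cases hy : y ∈ S
      · rw [hd₁ s y hy, hd₁ s (g • y) (S.smul_mem g hy)]
        exact ConcreteCategory.congr_hom (s.inl.hom.hom.comm g) (⟨y, hy⟩ : S)
      · rw [hd₂ s y hy, hd₂ s (g • y) (Sc.smul_mem g hy)]
        exact ConcreteCategory.congr_hom (s.inr.hom.hom.comm g) (⟨y, hy⟩ : Sc)
    · intro s
      apply hom_ext_apply
      intro y
      change d s (y.1 : T.obj.obj.V) = s.inl.hom.hom.hom y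
      rw [hd₁ s y.1 y.2]
    · intro s
      apply hom_ext_apply
      intro y
      change d s (y.1 : T.obj.obj.V) = s.inr.hom.hom.hom y
      rw [hd₂ s y.1 y.2]
    · intro s m h₁ h₂
      apply hom_ext_apply
      intro y
      change m.hom.hom.hom y = d s y
      by_cases hy : y ∈ S
      · rw [hd₁ s y hy, ← h₁]
        rfl
      · rw [hd₂ s y hy, ← h₂]
        rfl
  -- contradiction with connectedness
  have h := hT.2 _ _ (ι S) (ι Sc) (hne S ⟨x₀, MulAction.mem_orbit_self x₀⟩) (hne Sc ⟨x, hx'⟩)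
  exact h.false hcol.some

/-- A connected object of `B^temp(Π, Π°)` has a point (it is non-initial, and the empty `Π`-set is
initial). (Step of the verification of FrdII Ex. 1.3 (i).)
[cite: MochizukiFrdII2008, Ex 1.3 (i) p.11] -/
theorem nonempty_of_isConnectedObj (T : BTempRel G H) (hT : IsConnectedObj T) :
    Nonempty T.obj.obj.V :=
  nonempty_of_isNonemptyObj T hT.1

/-- Conversely, a single `Π`-orbit is a connected object of `B^temp(Π, Π°)`: it has a point, and a
coproduct decomposition `B₁ ⊔ B₂` with `B₁, B₂` non-initial would give a `Π`-map to the disjoint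
union of two copies of the orbit separating the images of `B₁` and `B₂`, which is absurd since these
images are `Π`-translates of each other. [cite: MochizukiFrdII2008, Ex 1.3 (i) p.11] -/
theorem isConnectedObj_of_transitive (T : BTempRel G H) (x₀ : T.obj.obj.V)
    (htr : ∀ x : T.obj.obj.V, ∃ g : G, T.obj.obj.ρ g x₀ = x) : IsConnectedObj T := by
  classical
  letI : MulAction G T.obj.obj.V := Action.instMulAction T.obj.obj
  refine ⟨isNonemptyObj_of_nonempty T x₀, fun B₁ B₂ ι₁ ι₂ h₁ h₂ => ⟨fun hc => ?_⟩⟩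
  obtain ⟨t⟩ := T.property
  -- the disjoint union of two copies of `T`
  let ZA : Action (Type u) G := Action.ofMulAction G (T.obj.obj.V ⊕ T.obj.obj.V)
  let Z : BTempRel G H :=
    ⟨⟨ZA, by
      haveI : Countable T.obj.obj.V := T.obj.property.1
      refine ⟨inferInstanceAs (Countable (T.obj.obj.V ⊕ T.obj.obj.V)), fun y => ?_⟩
      rcases y with y | y
      · have : {g : G | ZA.ρ g (Sum.inl y) = Sum.inl y} = {g : G | T.obj.obj.ρ g y = y} := by
          ext g
          simp only [Set.mem_setOf_eq]
          change g • (Sum.inl y : T.obj.obj.V ⊕ T.obj.obj.V) = Sum.inl y ↔ g • y = y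
          rw [Sum.smul_inl, Sum.inl.injEq]
        rw [this]
        exact T.obj.property.2 y
      · have : {g : G | ZA.ρ g (Sum.inr y) = Sum.inr y} = {g : G | T.obj.obj.ρ g y = y} := by
          ext g
          simp only [Set.mem_setOf_eq]
          change g • (Sum.inr y : T.obj.obj.V ⊕ T.obj.obj.V) = Sum.inr y ↔ g • y = y
          rw [Sum.smul_inr, Sum.inr.injEq]
        rw [this]
        exact T.obj.property.2 y⟩,
      ⟨{ hom := TypeCat.ofHom (Sum.elim (fun y => t.hom y) (fun y => t.hom y)),
         comm := fun g => by
            apply ConcreteCategory.hom_ext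
            intro y
            rcases y with y | y
            · change Sum.elim (fun y => t.hom y) (fun y => t.hom y)
                  (g • (Sum.inl y : T.obj.obj.V ⊕ T.obj.obj.V)) = (cosetAction G H).ρ g (t.hom y)
              rw [Sum.smul_inl, Sum.elim_inl]
              exact ConcreteCategory.congr_hom (t.comm g) y
            · change Sum.elim (fun y => t.hom y) (fun y => t.hom y)
                  (g • (Sum.inr y : T.obj.obj.V ⊕ T.obj.obj.V)) = (cosetAction G H).ρ g (t.hom y)
              rw [Sum.smul_inr, Sum.elim_inr]
              exact ConcreteCategory.congr_hom (t.comm g) y }⟩⟩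
  let inl : T ⟶ Z := ObjectProperty.homMk (ObjectProperty.homMk
    { hom := TypeCat.ofHom fun y => (Sum.inl y : T.obj.obj.V ⊕ T.obj.obj.V)
      comm := fun g => by
        apply ConcreteCategory.hom_ext
        intro y
        change (Sum.inl (T.obj.obj.ρ g y) : T.obj.obj.V ⊕ T.obj.obj.V) =
          g • (Sum.inl y : T.obj.obj.V ⊕ T.obj.obj.V)
        rw [Sum.smul_inl]
        rfl })
  let inr : T ⟶ Z := ObjectProperty.homMk (ObjectProperty.homMk
    { hom := TypeCat.ofHom fun y => (Sum.inr y : T.obj.obj.V ⊕ T.obj.obj.V)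
      comm := fun g => by
        apply ConcreteCategory.hom_ext
        intro y
        change (Sum.inr (T.obj.obj.ρ g y) : T.obj.obj.V ⊕ T.obj.obj.V) =
          g • (Sum.inr y : T.obj.obj.V ⊕ T.obj.obj.V)
        rw [Sum.smul_inr]
        rfl })
  -- the comparison map `T → T ⊔ T` sending `B₁` to the left and `B₂` to the right copy
  let d : T ⟶ Z := hc.desc (BinaryCofan.mk (ι₁ ≫ inl) (ι₂ ≫ inr))
  have hd₁ : ι₁ ≫ d = ι₁ ≫ inl := hc.fac (BinaryCofan.mk (ι₁ ≫ inl) (ι₂ ≫ inr)) ⟨WalkingPair.left⟩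
  have hd₂ : ι₂ ≫ d = ι₂ ≫ inr := hc.fac (BinaryCofan.mk (ι₁ ≫ inl) (ι₂ ≫ inr)) ⟨WalkingPair.right⟩
  obtain ⟨b₁⟩ := nonempty_of_isNonemptyObj B₁ h₁
  obtain ⟨b₂⟩ := nonempty_of_isNonemptyObj B₂ h₂
  have e₁ : (d.hom.hom.hom (ι₁.hom.hom.hom b₁) : T.obj.obj.V ⊕ T.obj.obj.V) =
      Sum.inl (ι₁.hom.hom.hom b₁) := by
    change ((ι₁ ≫ d).hom.hom.hom b₁ : T.obj.obj.V ⊕ T.obj.obj.V) = _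
    rw [hd₁]
    rfl
  have e₂ : (d.hom.hom.hom (ι₂.hom.hom.hom b₂) : T.obj.obj.V ⊕ T.obj.obj.V) =
      Sum.inr (ι₂.hom.hom.hom b₂) := by
    change ((ι₂ ≫ d).hom.hom.hom b₂ : T.obj.obj.V ⊕ T.obj.obj.V) = _
    rw [hd₂]
    rfl
  -- the two points of `T` are translates of each other
  obtain ⟨g₁, hg₁⟩ := htr (ι₁.hom.hom.hom b₁)
  obtain ⟨g₂, hg₂⟩ := htr (ι₂.hom.hom.hom b₂)
  have key : T.obj.obj.ρ (g₂ * g₁⁻¹) (ι₁.hom.hom.hom b₁) = ι₂.hom.hom.hom b₂ := by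
    rw [← hg₁, ← ρ_mul_apply, mul_assoc, inv_mul_cancel, mul_one, hg₂]
  have := hom_ρ d (g₂ * g₁⁻¹) (ι₁.hom.hom.hom b₁)
  rw [key, e₂, e₁] at this
  change (Sum.inr _ : T.obj.obj.V ⊕ T.obj.obj.V) =
    (g₂ * g₁⁻¹) • (Sum.inl _ : T.obj.obj.V ⊕ T.obj.obj.V) at this
  rw [Sum.smul_inl] at this
  exact Sum.inr_ne_inl this

/-! ### Maps out of a single orbit -/

/-- Two morphisms of `B^temp(Π, Π°)` out of a connected object that agree at one point are equal.
(Step of the verification of FrdII Ex. 1.3 (i).)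
[cite: MochizukiFrdII2008, Ex 1.3 (i) p.11] -/
theorem hom_eq_of_apply_eq {T₁ T₂ : BTempRel G H} (hT₁ : IsConnectedObj T₁)
    (f f' : T₁ ⟶ T₂) (x₀ : T₁.obj.obj.V)
    (h : (f.hom.hom.hom x₀ : T₂.obj.obj.V) = f'.hom.hom.hom x₀) : f = f' := by
  apply hom_ext_apply
  intro x
  obtain ⟨g, rfl⟩ := exists_ρ_eq_of_isConnectedObj T₁ hT₁ x₀ x
  rw [hom_ρ, hom_ρ, h]

/-- A morphism of `B^temp(Π, Π°)` from an object with a point to a connected object is surjective on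
points (its image is a nonempty stable subset of a single orbit).
(Step of the verification of FrdII Ex. 1.3 (i).)
[cite: MochizukiFrdII2008, Ex 1.3 (i) p.11] -/
theorem surjective_of_isConnectedObj {T₁ T₂ : BTempRel G H} (x₁ : T₁.obj.obj.V)
    (hT₂ : IsConnectedObj T₂) (f : T₁ ⟶ T₂) (y : T₂.obj.obj.V) :
    ∃ x : T₁.obj.obj.V, (f.hom.hom.hom x : T₂.obj.obj.V) = y := by
  obtain ⟨g, hg⟩ := exists_ρ_eq_of_isConnectedObj T₂ hT₂ (f.hom.hom.hom x₁) y
  exact ⟨T₁.obj.obj.ρ g x₁, by rw [hom_ρ, hg]⟩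

/-- Descent of maps out of a single orbit: if `T₁` is the orbit of `r₀` and the stabiliser of `r₀`
fixes `x ∈ T₂`, then `r₀ ↦ x` extends to a morphism `T₁ → T₂` of `B^temp(Π, Π°)`.
(Step of the verification of FrdII Ex. 1.3 (i).)
[cite: MochizukiFrdII2008, Ex 1.3 (i) p.11] -/
theorem exists_hom_of_stabilizer_le {T₁ T₂ : BTempRel G H} (r₀ : T₁.obj.obj.V)
    (htr : ∀ r : T₁.obj.obj.V, ∃ g : G, T₁.obj.obj.ρ g r₀ = r) (x : T₂.obj.obj.V)
    (hle : ∀ g : G, T₁.obj.obj.ρ g r₀ = r₀ → T₂.obj.obj.ρ g x = x) :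
    ∃ f : T₁ ⟶ T₂, (f.hom.hom.hom r₀ : T₂.obj.obj.V) = x := by
  classical
  -- a section of the orbit map
  let σ : T₁.obj.obj.V → G := fun r => (htr r).choose
  have hσ : ∀ r, T₁.obj.obj.ρ (σ r) r₀ = r := fun r => (htr r).choose_spec
  -- the candidate map and its independence of the section
  let φ : T₁.obj.obj.V → T₂.obj.obj.V := fun r => T₂.obj.obj.ρ (σ r) x
  have hφ : ∀ (g : G), φ (T₁.obj.obj.ρ g r₀) = T₂.obj.obj.ρ g x := by
    intro g
    change T₂.obj.obj.ρ (σ (T₁.obj.obj.ρ g r₀)) x = T₂.obj.obj.ρ g x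
    have h1 : T₁.obj.obj.ρ (g⁻¹ * σ (T₁.obj.obj.ρ g r₀)) r₀ = r₀ := by
      rw [ρ_mul_apply, hσ, ρ_inv_apply]
    have h2 := hle _ h1
    rw [ρ_mul_apply] at h2
    have h3 := congrArg (T₂.obj.obj.ρ g) h2
    rw [← ρ_mul_apply, mul_inv_cancel, ρ_one_apply] at h3
    exact h3
  refine ⟨ObjectProperty.homMk (ObjectProperty.homMk
    { hom := TypeCat.ofHom φ
      comm := fun g => ?_ }), ?_⟩
  · apply ConcreteCategory.hom_ext
    intro r
    change φ (T₁.obj.obj.ρ g r) = T₂.obj.obj.ρ g (φ r)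
    obtain ⟨g', rfl⟩ := htr r
    rw [← ρ_mul_apply, hφ, hφ, ρ_mul_apply]
  · change φ r₀ = x
    have := hφ 1
    rw [ρ_one_apply, ρ_one_apply] at this
    exact this

end BTempRel

end QuasiTemperoid

end Literature.AlgebraicGeometry.Frobenioids
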